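import Summits.Ventures.PercRepro.LemmaBSlackTwo

/-!
# Lemma B whenever there are at most `|S| + 1` antipodal crossing pairs

A regime statement for Lemma B that does not mention the column count: for every monotone
`c : Config S → Setoid (Fin 4)`, if `crossCount ≤ Fintype.card S + 1` then
`crossCount ≤ topBotCount`.

* With all three crossing-pair types present, the empty configuration and the `|S|` singleton
  configurations are `⊥`-members of `{⊤, ⊥}` antipodal pairs
  (`card_add_one_le_topBotCount_of_threeTypes`, `LemmaBSlackTwo.lean`), so
  `topBotCount ≥ |S| + 1 ≥ crossCount`.
* With a type absent, every bad pair touches one cell (`crossFam_eq_empty_of_not_threeTypes`) and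
  the column theorem `crossCount_le_topBotCount_of_column` applies.

Together with `crossCount_le_topBotCount_of_le_columnCount_add_two'` (at most two pairs avoid some
cell) and the transversal / overlap bounds of `CrossTransversal.lean`, this is the list of regimes
of Lemma B proved in this lane; the general three-type case remains open (`proofs/P4-gen9.md` §11).
-/

namespace PercRepro

variable {S : Type} [Fintype S] [DecidableEq S]

/-- **Lemma B for at most `|S| + 1` crossing pairs**: for every monotone
`c : Config S → Setoid (Fin 4)`, `crossCount ≤ Fintype.card S + 1 → crossCount ≤ topBotCount`.
Three types: `∅` and the `|S|` singletons are `⊥`-members of good pairs; otherwise the column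
theorem. -/
theorem crossCount_le_topBotCount_of_le_card_add_one (c : Config S → Setoid (Fin 4))
    (hc : Monotone c) (h : crossCount cross4 c ≤ Fintype.card S + 1) :
    crossCount cross4 c ≤ topBotCount c := by
  by_cases h3 : ThreeTypes c
  · exact h.trans (card_add_one_le_topBotCount_of_threeTypes c hc h3)
  · obtain ⟨i', hi'⟩ := crossFam_eq_empty_of_not_threeTypes h3
    exact crossCount_le_topBotCount_of_column cross4 c cross4_isCrossingFamily hc i' hi'

/-- **Three types force at least `|S| + 1` good pairs** — restated with the crossing count: a map
with all three types and `topBotCount < crossCount` must have more than `|S| + 1` bad pairs. -/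
theorem card_add_one_lt_crossCount_of_lt_topBotCount (c : Config S → Setoid (Fin 4))
    (hc : Monotone c) (h3 : ThreeTypes c) (hlt : topBotCount c < crossCount cross4 c) :
    Fintype.card S + 1 < crossCount cross4 c :=
  lt_of_le_of_lt (card_add_one_le_topBotCount_of_threeTypes c hc h3) hlt

end PercRepro
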